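import Mathlib
import Literature.Analysis.Complex.LaplaceHalfLine
import Summits.AnomalousDissipation.AnomalousDissipation.Theorems.SoloBlindLaplaceOfExp

/-!
# Solo-blind kernel #274 — numerical abscissa ⇒ semigroup growth bound (bounded Lumer–Phillips)

The input `hK : ∀ t ≥ 0, ‖e^{tA}‖ ≤ K e^{γt}` of kernel #270 (`laplaceC_readout`: `𝓛k = R` on
`Re s > γ`) and of kernels #266/#267/#273 (the exponential order `γ < b` of the read-out kernel
`k(t) = ℓ(e^{tJ} V)`) is produced here from a ONE-SIDED, CERTIFIABLE datum: the numerical abscissa.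
For a bounded operator `A` on a complex Hilbert space with `Re ⟪A w, w⟫ ≤ μ ‖w‖²` for all `w`,
`‖e^{tA} v‖ ≤ e^{μt} ‖v‖` (`norm_orbit_apply_le`) and `‖e^{tA}‖ ≤ 1 · e^{μt}` (`norm_orbit_le`) for
`t ≥ 0`; in particular `𝓛(ℓ(e^{tA} b))(s) = ℓ((s•1−A)⁻¹ b)` for `Re s > μ` (`laplaceC_readout_of_abscissa`).
For the truncated chain generator `J` (a finite matrix) `μ < 0` is a finite eigenvalue computation on
its Hermitian part — this is what makes "the half-plane `Re z > 0` is structural" (ENGINE-L-SPEC §9,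
§13 region (0)) a checkable statement.  Proof: energy identity `d/dt ‖u‖² = 2 Re⟪Au, u⟫ ≤ 2μ‖u‖²`
and monotonicity of `e^{−2μt}‖u(t)‖²`.
-/

namespace Summit.AnomalousDissipation.SoloBlind.NumericalAbscissa

open Complex NormedSpace Literature.Analysis.Complex
open Summit.AnomalousDissipation.SoloBlind.LaplaceOfExp
open scoped InnerProductSpace

variable {H : Type*} [NormedAddCommGroup H] [InnerProductSpace ℂ H] [CompleteSpace H]

/-- The orbit of a vector: `u(t) = e^{tA} v` solves `u' = A u`. -/
theorem hasDerivAt_orbit_apply (A : H →L[ℂ] H) (v : H) (t : ℝ) :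
    HasDerivAt (fun τ : ℝ => orbit A τ v) (A (orbit A t v)) t := by
  have h := (((ContinuousLinearMap.apply ℂ H v).restrictScalars ℝ).hasFDerivAt).comp_hasDerivAt t
    (hasDerivAt_orbit A t)
  simpa [Function.comp_def] using h

/-- Energy identity: `d/dt ‖e^{tA} v‖² = 2 Re ⟪A u, u⟫` with `u = e^{tA} v`. -/
theorem hasDerivAt_norm_sq_orbit (A : H →L[ℂ] H) (v : H) (t : ℝ) :
    HasDerivAt (fun τ : ℝ => ‖orbit A τ v‖ ^ 2)
      (2 * (⟪A (orbit A t v), orbit A t v⟫_ℂ).re) t := by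
  have hu := hasDerivAt_orbit_apply A v t
  have hinner := hu.inner ℂ hu
  have hre := (Complex.reCLM.hasFDerivAt).comp_hasDerivAt t hinner
  have hfun : (fun τ : ℝ => ‖orbit A τ v‖ ^ 2)
      = (Complex.reCLM : ℂ → ℝ) ∘ fun τ : ℝ => ⟪orbit A τ v, orbit A τ v⟫_ℂ := by
    funext τ
    have h := inner_self_eq_norm_sq (𝕜 := ℂ) (orbit A τ v)
    simp only [Function.comp_apply, Complex.reCLM_apply]
    simpa using h.symm
  have hsymm : (⟪orbit A t v, A (orbit A t v)⟫_ℂ).re = (⟪A (orbit A t v), orbit A t v⟫_ℂ).re := by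
    have h := inner_re_symm (𝕜 := ℂ) (orbit A t v) (A (orbit A t v))
    simpa using h
  rw [hfun]
  refine hre.congr_deriv ?_
  simp only [Complex.reCLM_apply, Complex.add_re, hsymm]
  ring

/-- **Numerical abscissa bound, vector form**: `Re ⟪A w, w⟫ ≤ μ‖w‖²` for all `w` implies
`‖e^{tA} v‖ ≤ e^{μt} ‖v‖` for `t ≥ 0`. -/
theorem norm_orbit_apply_le (A : H →L[ℂ] H) {μ : ℝ}
    (hμ : ∀ w : H, (⟪A w, w⟫_ℂ).re ≤ μ * ‖w‖ ^ 2) (v : H) {t : ℝ} (ht : 0 ≤ t) :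
    ‖orbit A t v‖ ≤ Real.exp (μ * t) * ‖v‖ := by
  -- ψ(τ) = e^{-2μτ} ‖u τ‖² is antitone
  have hderiv : ∀ τ : ℝ, HasDerivAt (fun τ : ℝ => Real.exp (-2 * μ * τ) * ‖orbit A τ v‖ ^ 2)
      (Real.exp (-2 * μ * τ) * (2 * (⟪A (orbit A τ v), orbit A τ v⟫_ℂ).re
        - 2 * μ * ‖orbit A τ v‖ ^ 2)) τ := by
    intro τ
    have h0 : HasDerivAt (fun τ : ℝ => -2 * μ * τ) (-2 * μ) τ := by
      simpa using (hasDerivAt_id τ).const_mul (-2 * μ)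
    have h1 : HasDerivAt (fun τ : ℝ => Real.exp (-2 * μ * τ)) (Real.exp (-2 * μ * τ) * (-2 * μ)) τ :=
      h0.exp
    exact (h1.mul (hasDerivAt_norm_sq_orbit A v τ)).congr_deriv (by ring)
  have hψdiff : Differentiable ℝ (fun τ : ℝ => Real.exp (-2 * μ * τ) * ‖orbit A τ v‖ ^ 2) :=
    fun τ => (hderiv τ).differentiableAt
  have hψ' : ∀ τ : ℝ, deriv (fun τ : ℝ => Real.exp (-2 * μ * τ) * ‖orbit A τ v‖ ^ 2) τ ≤ 0 := by
    intro τ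
    rw [(hderiv τ).deriv]
    have hpos : 0 < Real.exp (-2 * μ * τ) := Real.exp_pos _
    have hle := hμ (orbit A τ v)
    have hinner : 2 * (⟪A (orbit A τ v), orbit A τ v⟫_ℂ).re - 2 * μ * ‖orbit A τ v‖ ^ 2 ≤ 0 := by
      linarith
    exact mul_nonpos_of_nonneg_of_nonpos hpos.le hinner
  have hanti := antitone_of_deriv_nonpos hψdiff hψ'
  have h0 : Real.exp (-2 * μ * t) * ‖orbit A t v‖ ^ 2 ≤ ‖v‖ ^ 2 := by
    have h := hanti ht
    simpa [orbit_zero] using h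
  -- multiply through by e^{2μt}
  have hsq : ‖orbit A t v‖ ^ 2 ≤ (Real.exp (μ * t) * ‖v‖) ^ 2 := by
    have hexp : Real.exp (2 * μ * t) * Real.exp (-2 * μ * t) = 1 := by
      have e : 2 * μ * t + -2 * μ * t = 0 := by ring
      rw [← Real.exp_add, e, Real.exp_zero]
    have hsq' : (Real.exp (μ * t)) ^ 2 = Real.exp (2 * μ * t) := by
      rw [sq, ← Real.exp_add]; congr 1; ring
    calc ‖orbit A t v‖ ^ 2
        = Real.exp (2 * μ * t) * (Real.exp (-2 * μ * t) * ‖orbit A t v‖ ^ 2) := by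
          rw [← mul_assoc, hexp, one_mul]
      _ ≤ Real.exp (2 * μ * t) * ‖v‖ ^ 2 :=
          mul_le_mul_of_nonneg_left h0 (Real.exp_pos _).le
      _ = (Real.exp (μ * t) * ‖v‖) ^ 2 := by rw [mul_pow, hsq']
  have hnn : 0 ≤ Real.exp (μ * t) * ‖v‖ := by positivity
  exact (pow_le_pow_iff_left₀ (norm_nonneg _) hnn two_ne_zero).1 hsq

/-- **Numerical abscissa bound, operator form**: `‖e^{tA}‖ ≤ 1 · e^{μt}` for `t ≥ 0` — the
hypothesis `hK` of kernel #270 with `K = 1`, `γ = μ`. -/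
theorem norm_orbit_le (A : H →L[ℂ] H) {μ : ℝ}
    (hμ : ∀ w : H, (⟪A w, w⟫_ℂ).re ≤ μ * ‖w‖ ^ 2) :
    ∀ t : ℝ, 0 ≤ t → ‖orbit A t‖ ≤ 1 * Real.exp (μ * t) := by
  intro t ht
  rw [one_mul]
  exact ContinuousLinearMap.opNorm_le_bound _ (Real.exp_pos _).le
    (fun v => norm_orbit_apply_le A hμ v ht)

/-- **`𝓛k = R` from the numerical abscissa**: for `Re s > μ`, `s•1 − A` is a unit and
`𝓛(t ↦ ℓ(e^{tA} b))(s) = ℓ((s•1−A)⁻¹ b)`; the read-out kernel has exponential order `μ`. -/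
theorem laplaceC_readout_of_abscissa (A : H →L[ℂ] H) {μ : ℝ}
    (hμ : ∀ w : H, (⟪A w, w⟫_ℂ).re ≤ μ * ‖w‖ ^ 2) (ℓ : (H →L[ℂ] H) →L[ℂ] ℂ) (b : H →L[ℂ] H) :
    HalfLineExpBound (fun t : ℝ => ℓ (orbit A t * b)) (‖ℓ‖ * 1 * ‖b‖) μ ∧
    ∀ z : ℂ, μ < z.re →
      IsUnit (resolventElt z A) ∧ laplaceC (fun t : ℝ => ℓ (orbit A t * b)) z
        = ℓ (Ring.inverse (resolventElt z A) * b) :=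
  ⟨halfLineExpBound_readout (norm_orbit_le A hμ) ℓ b,
   fun _ hz => ⟨isUnit_resolvent (norm_orbit_le A hμ) hz,
     laplaceC_readout (norm_orbit_le A hμ) hz ℓ b⟩⟩

end Summit.AnomalousDissipation.SoloBlind.NumericalAbscissa
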